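import Summits.NavierStokesRegularity.NavierStokesRegularity.Theses.AxisymmetricExtremality
import Literature.Analysis.FluidPDE.SereginZajaczkowski2007
import Literature.Analysis.FluidPDE.SuitableWeakRescaling
import Literature.Analysis.FluidPDE.SuitableWeakInBallTools
import Literature.Analysis.FluidPDE.SereginSverakOffAxisScaling
import Literature.Analysis.FluidPDE.LocalTypeIScaling
import Literature.Analysis.FluidPDE.LeiZhang2011ZoomIn
import HarnessLib

/-!
# Seregin 2022, §2: covariance of the clean-slab data under the Navier–Stokes scaling about an
# axis point —
# crux stmt-NavierStokesRegularity-15453 (`AxisymmetricExtremality.AxisymmetricKatoGlobal`), line registered, support for stub `stub_sereginLogSwirlOrigin`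

Support file (`--supports stmt-NavierStokesRegularity-15453`; theorems only, everything proved)
toward the registered stub `stub_sereginLogSwirlOrigin` = the named fact
`Literature.Analysis.FluidPDE.seregin2022_logSwirl_regularAtOrigin` (G. Seregin, J. Math. Fluid
Mech. 24 (2022), Paper 27 = arXiv:2201.00153, §2).  First of three files normalising the
classical core of the fact (the hypothesis `core` of
`seregin2022_logSwirl_regularAtOrigin_of_cleanRepr`, sibling `…FinalReduction`), stated at a
general axis point `ẑ = (t̂, b e₃)` and scale `R`, to the origin at unit scale by the parabolic
scaling `v_R(s, y) = R v(t̂ + R² s, b e₃ + R y)`, `q_R = R² q(…)` (`ν = 1` is scale invariant;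
the accepted vocabulary is `R • stPull (R²) R t̂ (b • eZ) v`, `SpaceTimeRescaling.lean`).

This file proves the covariance of the individual ingredients:

* `iteratedFDeriv_smul_comp_axisZoom`, `norm_smul_compContinuousLinearMap_smul_id_le` — the
  chain rule `D_yⁿ(a V(t, x̂ + R ·))(y) = a DⁿV(t, x̂ + R y) ∘ (R id)^{⊗n}` and the bound
  `‖…‖ ≤ |a| |R|ⁿ ‖DⁿV‖`;
* `isSmoothAxisymmetricSolutionOn_axisZoom` — **the Seregin–Zajaczkowski class
  `IsSmoothAxisymmetricSolutionOn` is covariant**: `(R V ∘ Φ, R² q ∘ Φ)` is a sufficiently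
  smooth axially symmetric solution on `Φ⁻¹(S)` (`Φ(s, y) = (t̂ + R² s, b e₃ + R y)`; suitable
  weak solutions by the accepted `IsSuitableWeakSolutionOn.stRescale`, axial symmetry because
  `b e₃` is fixed by the rotations, smooth slices and locally Hölder spatial derivatives by the
  chain rule and the Lipschitz map `Φ`);
* `stAffine_preimage_parabolicCylinder_axisZoom`, `parCylOpens_axisZoom` — `Φ` maps `Q_{ρ/R}(0, a)` onto
  `Q_ρ(t̂, b e₃ + R a)` and `Q(0, 1)` onto `Q(ẑ, R)`;
* `abs_swirl_axisZoom_le` — **the swirl bound (2.2) is scale-monotone**: the swirl is invariant,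
  `σ_{v_R}(s, y) = σ_v(Φ(s, y))` (`swirl_smul_comp_eZ_smul`), and for `0 < R ≤ 1`,
  `0 < ϱ < 1`: `ln(e/(Rϱ)) ≥ ln(e/ϱ) > 0`, so `|σ| ≤ C₁/ln³(e/|x'|)` at `Φ(s, y)` gives
  `|σ_{v_R}(s, y)| ≤ max(C₁, 0)/ln³(e/|y'|)`;
* `backwardRegular_of_axisZoom` — an `L_∞` bound of `v_R` on `Q_r(0)` is an `L_∞` bound of `v` on
  `Q_{Rr}(ẑ)` (accepted `eLpNorm_top_nsZoom`).

## References

* G. Seregin, J. Math. Fluid Mech. 24 (2022), Paper No. 27 = arXiv:2201.00153, §2 (the proof is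
  written at the origin and unit scale: "`Q = 𝒞 × ]-1, 0[`"). [`Seregin2022LocalAxisym`]
* G. Seregin, W. Zajaczkowski, SIAM J. Math. Anal. 39 (2007) 669–685, §5 (the scaling
  `u^R(x,t) = R u(Rx + be₃, R²t)` of a sufficiently smooth axially symmetric solution).
  [`SereginZajaczkowski2007`]
* L. Caffarelli, R. Kohn, L. Nirenberg, Comm. Pure Appl. Math. 35 (1982), §2 (scaling).
  [`CaffarelliKohnNirenberg1982`]
-/

-- the problem directory repeats the summit name (D-0017); core's `dupNamespace` linter fires
set_option linter.dupNamespace false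

noncomputable section

open MeasureTheory Set Function Filter Topology TopologicalSpace Metric
open scoped NNReal ENNReal

namespace Summit.NavierStokesRegularity.NavierStokesRegularity.Theorems.AxisymmetricKatoGlobal.EulerScaling

open Literature.Analysis.FluidPDE Literature.Analysis.FluidPDE.SereginZajaczkowski2007
  Literature.Analysis.FluidPDE.SereginSverak2009

/-! ### The chain rule for the spatial zoom -/

open scoped ContDiff in
/-- **Spatial derivatives of the zoomed slice.** For `f` smooth at `x₀ + c x` (`c ≠ 0`), the `k`-th
derivative of `x' ↦ a f(x₀ + c x')` at `x` is `a` times the `k`-th derivative of `f` at `x₀ + c x`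
composed with `c · id` in each slot (Mathlib's `ContinuousLinearEquiv.iteratedFDerivWithin_comp_right`,
`iteratedFDeriv_comp_add_left`, `iteratedFDeriv_const_smul_apply'`). [folklore] -/
theorem iteratedFDeriv_smul_comp_axisZoom {c : ℝ} (hc : c ≠ 0) (a : ℝ)
    (f : EuclideanSpace ℝ (Fin 3) → EuclideanSpace ℝ (Fin 3)) (x₀ x : EuclideanSpace ℝ (Fin 3)) (k : ℕ)
    (hf : ContDiffAt ℝ ∞ f (x₀ + c • x)) :
    iteratedFDeriv ℝ k (fun x' => a • f (x₀ + c • x')) x =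
      a • (iteratedFDeriv ℝ k f (x₀ + c • x)).compContinuousLinearMap
        (fun _ => c • ContinuousLinearMap.id ℝ (EuclideanSpace ℝ (Fin 3))) := by
  -- adapted from `iteratedFDeriv_zoom_symm` (`Literature/Analysis/FluidPDE/SuitableWeakInBallTools.lean`)
  set L : EuclideanSpace ℝ (Fin 3) ≃L[ℝ] EuclideanSpace ℝ (Fin 3) :=
    ContinuousLinearEquiv.equivOfInverse (c • ContinuousLinearMap.id ℝ (EuclideanSpace ℝ (Fin 3)))
      (c⁻¹ • ContinuousLinearMap.id ℝ (EuclideanSpace ℝ (Fin 3)))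
      (fun y => by simp [smul_smul, hc]) (fun y => by simp [smul_smul, hc]) with hL
  have hLapply : ∀ y, L y = c • y := fun y => rfl
  have hLcoe : (L : EuclideanSpace ℝ (Fin 3) →L[ℝ] EuclideanSpace ℝ (Fin 3)) =
      c • ContinuousLinearMap.id ℝ (EuclideanSpace ℝ (Fin 3)) := rfl
  set g : EuclideanSpace ℝ (Fin 3) → EuclideanSpace ℝ (Fin 3) := fun x' => f (x₀ + c • x') with hg
  have hgcomp : g = (fun y => f (x₀ + y)) ∘ L := by
    funext x'
    simp only [hg, comp_apply, hLapply]
  have h1 : iteratedFDeriv ℝ k g x =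
      (iteratedFDeriv ℝ k f (x₀ + c • x)).compContinuousLinearMap fun _ =>
        (L : EuclideanSpace ℝ (Fin 3) →L[ℝ] EuclideanSpace ℝ (Fin 3)) := by
    have h := L.iteratedFDerivWithin_comp_right (fun y => f (x₀ + y)) uniqueDiffOn_univ
      (x := x) (mem_univ _) k
    rw [preimage_univ, iteratedFDerivWithin_univ, iteratedFDerivWithin_univ, ← hgcomp,
      iteratedFDeriv_comp_add_left] at h
    rw [h, hLapply]
  have haff : ContDiff ℝ ∞ fun x' : EuclideanSpace ℝ (Fin 3) => x₀ + c • x' :=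
    contDiff_const.add (contDiff_id.const_smul _)
  have hgx : ContDiffAt ℝ k g x := by
    have := hf.comp x haff.contDiffAt
    exact this.of_le (by exact_mod_cast le_top)
  have h2 : iteratedFDeriv ℝ k (fun x' => a • g x') x = a • iteratedFDeriv ℝ k g x :=
    iteratedFDeriv_const_smul_apply' hgx
  show iteratedFDeriv ℝ k (fun x' => a • g x') x = _
  rw [h2, h1, hLcoe]

/-- `‖a M ∘ (c id)^{⊗k}‖ ≤ |a| |c|ᵏ ‖M‖` for a continuous `k`-linear map `M`. [folklore] -/
theorem norm_smul_compContinuousLinearMap_smul_id_le {k : ℕ} (a c : ℝ)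
    (M : ContinuousMultilinearMap ℝ (fun _ : Fin k => EuclideanSpace ℝ (Fin 3)) (EuclideanSpace ℝ (Fin 3))) :
    ‖a • M.compContinuousLinearMap (fun _ => c • ContinuousLinearMap.id ℝ (EuclideanSpace ℝ (Fin 3)))‖ ≤
      |a| * |c| ^ k * ‖M‖ := by
  rw [norm_smul, Real.norm_eq_abs, mul_assoc]
  refine mul_le_mul_of_nonneg_left ?_ (abs_nonneg a)
  refine (ContinuousMultilinearMap.norm_compContinuousLinearMap_le _ _).trans ?_
  rw [Finset.prod_const, Finset.card_univ, Fintype.card_fin, mul_comm]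
  have hn : ‖c • ContinuousLinearMap.id ℝ (EuclideanSpace ℝ (Fin 3))‖ ≤ |c| := by
    rw [norm_smul, Real.norm_eq_abs]
    exact mul_le_of_le_one_right (abs_nonneg c) ContinuousLinearMap.norm_id_le
  exact mul_le_mul_of_nonneg_right (pow_le_pow_left₀ (norm_nonneg _) hn k) (norm_nonneg _)

/-! ### Covariance of the Seregin–Zajaczkowski class -/

open scoped ContDiff in
/-- **The Seregin–Zajaczkowski class is covariant under the Navier–Stokes scaling about an axis
point** (Seregin–Zajaczkowski 2007, §5: "`u^R(x, t) = R u(Rx + be₃, R²t)`" is again a sufficiently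
smooth axially symmetric solution): if `(V, P)` is a sufficiently smooth axially symmetric solution
on the open set `S`, then `(R V ∘ Φ, R² P ∘ Φ)`, `Φ(s, y) = (t₀ + R² s, b e₃ + R y)`, `R > 0`, is one
on `Φ⁻¹(S)`: the suitable weak solution is rescaled by the accepted covariance
`IsSuitableWeakSolutionOn.stRescale` (viscosity `R · 1 / R = 1`, force `0`), the axial symmetry
survives because the rotations about the axis fix `b e₃` and commute with dilations, the slices stay
`C^∞` by the chain rule, and the spatial derivatives `D_yⁿ(R V ∘ Φ) = R (DⁿV ∘ Φ) ∘ (R id)^{⊗n}` stay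
locally Hölder continuous (`Φ` Lipschitz, `M ↦ R M ∘ (R id)^{⊗n}` linear and bounded).
[cite: SereginZajaczkowski2007, §5 (the scaling `u^R`), with Prop. 4.1 (the class)] -/
theorem isSmoothAxisymmetricSolutionOn_axisZoom : ∀ (S : TopologicalSpace.Opens (ℝ × EuclideanSpace ℝ (Fin 3))) (V : ℝ → EuclideanSpace ℝ (Fin 3) → EuclideanSpace ℝ (Fin 3)) (P : ℝ → EuclideanSpace ℝ (Fin 3) → ℝ), SereginZajaczkowski2007.IsSmoothAxisymmetricSolutionOn S V P → ∀ (R t₀ b : ℝ), 0 < R → SereginZajaczkowski2007.IsSmoothAxisymmetricSolutionOn (stPreimage (R ^ 2) R t₀ (b • eZ) S) (R • stPull (R ^ 2) R t₀ (b • eZ) V) (R ^ 2 • stPull (R ^ 2) R t₀ (b • eZ) P) := by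
  intro S V P h R t₀ b hR
  refine ⟨?_, ?_, ?_, ?_⟩
  · -- suitable weak solution
    have h0 := h.suitable.stRescale hR hR (by ring : R ^ 2 = R * R) t₀ (b • eZ)
    have hvisc : R * 1 / R = 1 := by field_simp
    have hforce : ((R ^ 2 * R) • stPull (R ^ 2) R t₀ (b • eZ)
        (0 : ℝ → EuclideanSpace ℝ (Fin 3) → EuclideanSpace ℝ (Fin 3))) = 0 := by
      funext s y; simp [stPull]
    rwa [hvisc, hforce] at h0
  · -- axial symmetry
    intro θ z hz
    show R • V (t₀ + R ^ 2 * z.1) (b • eZ + R • rotZ θ z.2) =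
      rotZ θ (R • V (t₀ + R ^ 2 * z.1) (b • eZ + R • z.2))
    rw [← rotZ_smul_eZ_add_smul, rotZ_smul_vec]
    exact congrArg (R • ·) (h.axisymmetric θ (stAffine (R ^ 2) R t₀ (b • eZ) z) hz)
  · -- smooth slices
    intro z hz
    have haff : ContDiff ℝ ∞ fun x' : EuclideanSpace ℝ (Fin 3) => b • eZ + R • x' :=
      contDiff_const.add (contDiff_id.const_smul _)
    have h1 : ContDiffAt ℝ ∞ (fun x' => V (t₀ + R ^ 2 * z.1) (b • eZ + R • x')) z.2 :=
      (h.contDiffAt _ hz).comp z.2 haff.contDiffAt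
    exact h1.const_smul R
  · -- locally Hölder continuous spatial derivatives
    intro n z hz
    obtain ⟨U, hU, C, r, hr, hH⟩ := h.holder n (stAffine (R ^ 2) R t₀ (b • eZ) z) hz
    set Φ : ℝ × EuclideanSpace ℝ (Fin 3) → ℝ × EuclideanSpace ℝ (Fin 3) :=
      stAffine (R ^ 2) R t₀ (b • eZ) with hΦ
    set S' : Set (ℝ × EuclideanSpace ℝ (Fin 3)) :=
      ((stPreimage (R ^ 2) R t₀ (b • eZ) S : Opens (ℝ × EuclideanSpace ℝ (Fin 3))) :
        Set (ℝ × EuclideanSpace ℝ (Fin 3))) with hS'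
    -- the linear map `M ↦ R M ∘ (R id)^{⊗n}` and the Lipschitz zoom
    set Ψ : ContinuousMultilinearMap ℝ (fun _ : Fin n => EuclideanSpace ℝ (Fin 3)) (EuclideanSpace ℝ (Fin 3)) →L[ℝ]
        ContinuousMultilinearMap ℝ (fun _ : Fin n => EuclideanSpace ℝ (Fin 3)) (EuclideanSpace ℝ (Fin 3)) :=
      R • ContinuousMultilinearMap.compContinuousLinearMapL
        (fun _ : Fin n => R • ContinuousLinearMap.id ℝ (EuclideanSpace ℝ (Fin 3))) with hΨ
    have hΨapply : ∀ M : ContinuousMultilinearMap ℝ (fun _ : Fin n => EuclideanSpace ℝ (Fin 3))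
        (EuclideanSpace ℝ (Fin 3)),
        Ψ M = R • M.compContinuousLinearMap
          (fun _ => R • ContinuousLinearMap.id ℝ (EuclideanSpace ℝ (Fin 3))) := fun M => rfl
    have hΨlip : LipschitzWith ‖Ψ‖₊ Ψ := Ψ.lipschitz
    have hΦlip : LipschitzWith (max (Real.toNNReal (R ^ 2)) (Real.toNNReal R)) Φ :=
      lipschitzWith_stAffine (sq_nonneg R) hR.le _ _
    have hmaps : MapsTo Φ (Φ ⁻¹' U ∩ S') (U ∩ (S : Set (ℝ × EuclideanSpace ℝ (Fin 3)))) :=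
      fun w hw => ⟨hw.1, hw.2⟩
    have hcomp1 : HolderOnWith (C * max (Real.toNNReal (R ^ 2)) (Real.toNNReal R) ^ (r : ℝ)) (r * 1)
        ((fun w : ℝ × EuclideanSpace ℝ (Fin 3) => iteratedFDeriv ℝ n (V w.1) w.2) ∘ Φ)
        (Φ ⁻¹' U ∩ S') :=
      hH.comp hΦlip.lipschitzOnWith.holderOnWith hmaps
    have hcomp2 := (hΨlip.lipschitzOnWith (s := univ)).holderOnWith.comp hcomp1
      (fun _ _ => mem_univ _)
    have hformula : ∀ w ∈ Φ ⁻¹' U ∩ S',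
        iteratedFDeriv ℝ n ((R • stPull (R ^ 2) R t₀ (b • eZ) V) w.1) w.2 =
          (Ψ ∘ ((fun w : ℝ × EuclideanSpace ℝ (Fin 3) => iteratedFDeriv ℝ n (V w.1) w.2) ∘ Φ)) w := by
      intro w hw
      rw [comp_apply, comp_apply, hΨapply]
      exact iteratedFDeriv_smul_comp_axisZoom hR.ne' R (V (t₀ + R ^ 2 * w.1)) (b • eZ) w.2 n
        (h.contDiffAt (Φ w) hw.2)
    refine ⟨Φ ⁻¹' U, (continuous_stAffine _ _ _ _).continuousAt.preimage_mem_nhds hU,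
      ‖Ψ‖₊ * (C * max (Real.toNNReal (R ^ 2)) (Real.toNNReal R) ^ (r : ℝ)) ^ ((1 : ℝ≥0) : ℝ),
      1 * (r * 1), by positivity, ?_⟩
    intro w hw w' hw'
    show edist (iteratedFDeriv ℝ n ((R • stPull (R ^ 2) R t₀ (b • eZ) V) w.1) w.2)
      (iteratedFDeriv ℝ n ((R • stPull (R ^ 2) R t₀ (b • eZ) V) w'.1) w'.2) ≤ _
    rw [hformula w hw, hformula w' hw']
    exact hcomp2 w hw w' hw'

/-! ### Geometry of the zoom about an axis point -/

/-- `Φ(s, y) = (t̂ + R² s, x̂ + R y)` pulls the top-time cylinder `Q_ρ(t̂, x̂ + R a)` back to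
`Q_{ρ/R}(0, a)` (`R > 0`). [folklore] -/
theorem stAffine_preimage_parabolicCylinder_axisZoom {R : ℝ} (hR : 0 < R) (t₀ : ℝ)
    (x₀ a : EuclideanSpace ℝ (Fin 3)) (ρ : ℝ) :
    stAffine (R ^ 2) R t₀ x₀ ⁻¹' parabolicCylinder ρ ((t₀, x₀ + R • a) : ℝ × EuclideanSpace ℝ (Fin 3)) =
      parabolicCylinder (ρ / R) (((0 : ℝ), a) : ℝ × EuclideanSpace ℝ (Fin 3)) := by
  have h := LocalTypeIScaling.stAffine_preimage_parabolicCylinder hR t₀ x₀ (ρ / R)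
    (((0 : ℝ), a) : ℝ × EuclideanSpace ℝ (Fin 3))
  have h0 : stAffine (R ^ 2) R t₀ x₀ (((0 : ℝ), a) : ℝ × EuclideanSpace ℝ (Fin 3)) = (t₀, x₀ + R • a) := by
    simp [stAffine]
  rwa [h0, mul_div_cancel₀ _ hR.ne'] at h

/-- `Φ(s, y) = (t̂ + R² s, x̂ + R y)` pulls `Q(ẑ, R)`, `ẑ = (t̂, x̂)`, back to `Q(0, 1)` (`R > 0`).
[folklore] -/
theorem stAffine_preimage_parCyl_self {R : ℝ} (hR : 0 < R) (t₀ : ℝ) (x₀ : EuclideanSpace ℝ (Fin 3)) :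
    stAffine (R ^ 2) R t₀ x₀ ⁻¹' parCyl ((t₀, x₀) : ℝ × EuclideanSpace ℝ (Fin 3)) R =
      parCyl (0 : ℝ × EuclideanSpace ℝ (Fin 3)) 1 := by
  rw [stAffine_preimage_parCyl hR, div_self hR.ne']

/-- The same for the open sets: `Φ⁻¹(Q(ẑ, R)) = Q(0, 1)` in `Opens`. [folklore] -/
theorem parCylOpens_axisZoom {R : ℝ} (hR : 0 < R) (t₀ : ℝ) (x₀ : EuclideanSpace ℝ (Fin 3)) :
    stPreimage (R ^ 2) R t₀ x₀ (parCylOpens ((t₀, x₀) : ℝ × EuclideanSpace ℝ (Fin 3)) R) =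
      parCylOpens (0 : ℝ × EuclideanSpace ℝ (Fin 3)) 1 :=
  TopologicalSpace.Opens.ext (by
    rw [coe_stPreimage, coe_parCylOpens, coe_parCylOpens, stAffine_preimage_parCyl_self hR])

/-- Membership in `𝒞 = 𝒞(0, ρ)`: `|y'| < ρ`, `|y₃| < ρ`. [folklore] -/
theorem mem_spaceCyl_zero_iff {y : EuclideanSpace ℝ (Fin 3)} {ρ : ℝ} :
    y ∈ spaceCyl (0 : EuclideanSpace ℝ (Fin 3)) ρ ↔ cylRadius y < ρ ∧ |y 2| < ρ := by
  simp only [mem_spaceCyl, sub_zero, PiLp.zero_apply]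

/-- The space zoom `y ↦ b e₃ + R y` maps `𝒞(0, 1)` onto `𝒞(b e₃, R)` (`R > 0`). [folklore] -/
theorem axisZoom_mem_spaceCyl {R : ℝ} (hR : 0 < R) (b : ℝ) {y : EuclideanSpace ℝ (Fin 3)}
    (hy : y ∈ spaceCyl (0 : EuclideanSpace ℝ (Fin 3)) 1) : b • eZ + R • y ∈ spaceCyl (b • eZ) R := by
  have h : y ∈ (fun y : EuclideanSpace ℝ (Fin 3) => b • eZ + R • y) ⁻¹' spaceCyl (b • eZ) (R * 1) := by
    rw [preimage_spaceCyl_axisAffine hR b 1]; exact hy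
  rwa [mul_one] at h

/-! ### The swirl bound under the zoom -/

/-- **The swirl bound (2.2) is scale-monotone.** The swirl is invariant under the scaling about an
axis point, `σ_{R v(t, b e₃ + R ·)}(y) = σ_{v(t, ·)}(b e₃ + R y)` (`ϱ v_φ` with `ϱ = R ϱ'`,
`v ↦ R v`), `|(b e₃ + R y)'| = R |y'|`, and for `0 < R ≤ 1`, `0 < |y'| < 1` the logarithmic weight is
monotone, `ln(e/(R|y'|)) ≥ ln(e/|y'|) > 0`; hence `|σ_v(t, x)| ≤ C₁/ln³(e/|x'|)` at `x = b e₃ + R y`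
gives `|σ_{v_R}(y)| ≤ max(C₁, 0)/ln³(e/|y'|)`. [cite: Seregin2022LocalAxisym, (2.2) and §2 (reduction to `Q = 𝒞 × ]-1,0[`, arXiv:2201.00153 p. 5)] -/
theorem abs_swirl_axisZoom_le {w : EuclideanSpace ℝ (Fin 3) → EuclideanSpace ℝ (Fin 3)} {R b C₁ : ℝ}
    (hR : 0 < R) (hR1 : R ≤ 1) {y : EuclideanSpace ℝ (Fin 3)} (hy0 : 0 < cylRadius y)
    (hy1 : cylRadius y < 1)
    (hσ : |swirl w (b • eZ + R • y)| ≤ C₁ / Real.log (Real.exp 1 / cylRadius (b • eZ + R • y)) ^ 3) :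
    |swirl (fun y' => R • w (b • eZ + R • y')) y| ≤
      max C₁ 0 / Real.log (Real.exp 1 / cylRadius y) ^ 3 := by
  rw [swirl_smul_comp_eZ_smul w R b hR.ne' y, div_self hR.ne', one_mul]
  rw [cylRadius_axisAffine hR.le b y] at hσ
  have he : (1 : ℝ) < Real.exp 1 := by
    have := Real.add_one_lt_exp (one_ne_zero (α := ℝ))
    linarith
  have hL1 : 0 < Real.log (Real.exp 1 / cylRadius y) := by
    apply Real.log_pos
    rw [lt_div_iff₀ hy0]
    nlinarith
  have hL2 : Real.log (Real.exp 1 / cylRadius y) ≤ Real.log (Real.exp 1 / (R * cylRadius y)) := by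
    apply Real.log_le_log (div_pos (Real.exp_pos 1) hy0)
    exact div_le_div_of_nonneg_left (Real.exp_pos 1).le (mul_pos hR hy0) (by nlinarith)
  have hL3 : Real.log (Real.exp 1 / cylRadius y) ^ 3 ≤ Real.log (Real.exp 1 / (R * cylRadius y)) ^ 3 :=
    pow_le_pow_left₀ hL1.le hL2 3
  have hL4 : 0 < Real.log (Real.exp 1 / (R * cylRadius y)) ^ 3 := pow_pos (hL1.trans_le hL2) 3
  calc |swirl w (b • eZ + R • y)| ≤ C₁ / Real.log (Real.exp 1 / (R * cylRadius y)) ^ 3 := hσ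
    _ ≤ max C₁ 0 / Real.log (Real.exp 1 / (R * cylRadius y)) ^ 3 :=
      div_le_div_of_nonneg_right (le_max_left _ _) hL4.le
    _ ≤ max C₁ 0 / Real.log (Real.exp 1 / cylRadius y) ^ 3 :=
      div_le_div_of_nonneg_left (le_max_right _ _) (pow_pos hL1 3) hL3

/-! ### Transport of the `L_∞` bound back to the axis point -/

/-- **Backward regularity is transported back along the zoom**: if `v_R = R v ∘ Φ`,
`Φ(s, y) = (t̂ + R² s, x̂ + R y)`, is essentially bounded on `Q_r(0)`, then `v` is essentially
bounded on `Q_{Rr}(ẑ) = Φ(Q_r(0))`, `ẑ = (t̂, x̂)` (`‖v_R‖_{L_∞(Q_r(0))} = R ‖v‖_{L_∞(Q_{Rr}(ẑ))}`,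
accepted `eLpNorm_top_nsZoom`). [folklore] -/
theorem backwardRegular_of_axisZoom {v : ℝ → EuclideanSpace ℝ (Fin 3) → EuclideanSpace ℝ (Fin 3)}
    {R : ℝ} (hR : 0 < R) (t₀ : ℝ) (x₀ : EuclideanSpace ℝ (Fin 3))
    (h : ∃ r > 0, eLpNorm (uncurry (R • stPull (R ^ 2) R t₀ x₀ v)) ∞
      (volume.restrict (parabolicCylinder r (0 : ℝ × EuclideanSpace ℝ (Fin 3)))) < ∞) :
    ∃ r > 0, eLpNorm (uncurry v) ∞
      (volume.restrict (parabolicCylinder r ((t₀, x₀) : ℝ × EuclideanSpace ℝ (Fin 3)))) < ∞ := by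
  obtain ⟨r, hr, hfin⟩ := h
  have h1 := eLpNorm_top_nsZoom hR t₀ x₀ r (0 : ℝ × EuclideanSpace ℝ (Fin 3)) v
  have h0 : stAffine (R ^ 2) R t₀ x₀ (0 : ℝ × EuclideanSpace ℝ (Fin 3)) = (t₀, x₀) := by
    simp [stAffine]
  rw [h0] at h1
  rw [h1] at hfin
  refine ⟨R * r, mul_pos hR hr, ?_⟩
  rcases ENNReal.mul_lt_top_iff.1 hfin with h2 | h2 | h2
  · exact h2.2
  · exact absurd h2 (ENNReal.ofReal_pos.2 hR).ne'
  · rw [h2]; exact ENNReal.zero_lt_top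

end Summit.NavierStokesRegularity.NavierStokesRegularity.Theorems.AxisymmetricKatoGlobal.EulerScaling

end
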